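import Mathlib
import HarnessLib

/-!
# Saddle geometry on the fugacity torus, part 3: Cauchy–Taylor to second order with a cubic remainder

Helper file for route `TcThermcert1`, crux `ThermalStiffnessCeilingU8b10_le_1o8` (item `stmt-Ventures-26381`), line
`Cruxes/ThermalStiffnessCeilingU8b10_le_1o8/Lines/zerofree_corridor.lean` v8, registered stub `stub_saddleGeometry` (K3b).

Clause (ii) of the stub asks for two-sided quadratic control of the exponent near the critical point with an explicit cubic
error `K(|u|+|v|)³` and a SMALL imaginary quadratic part.  The line obtains it from one-variable slices
`t ↦ G(tu/m, tv/m)` (`m = max(|u|,|v|)`), which are complex analytic in `t` on a disc `|t| ≤ R₀`; this file supplies the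
model-free engine:

* `norm_cauchyPowerSeries_le_of_bound`: Cauchy's estimate `‖cₙ‖ ≤ B R⁻ⁿ` for the Cauchy coefficients of a function bounded by
  `B` on the circle `|z| = R`;
* `cauchy_taylor_two`: for `g` complex differentiable on `|z| ≤ R`, bounded by `B` on `|z| = R`, and `|t| ≤ R/2`:
  `‖g'(0)‖ ≤ B/R`, `‖g''(0)‖ ≤ 2B/R²` and `‖g(t) − g(0) − g'(0)t − g''(0)t²/2‖ ≤ 2B(|t|/R)³`
  (power series at `0` = Cauchy series, tail summed against the geometric majorant `B(|t|/R)ⁿ`).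

Applied to the `h`-part (`B = 2ε₁`) this makes the whole quadratic contribution of the perturbation `O(ε₁/R₀²)·(u²+v²)` — the
source of the `τ₀`-smallness in the stub — and to the logarithmic part it gives the cubic constant.  [folklore] No definitions;
no `sorry`.
-/

noncomputable section

open Complex Metric Set Finset

namespace Summit.Ventures.CertifiedManyBodySolver.Theorems.TcThermcert1.ZeroFreeCorridor

/-! ## §4 Cauchy–Taylor: second-order expansion with explicit cubic remainder -/

/-- Cauchy's coefficient estimate: if `g` is bounded by `B` on the circle `|z| = R`, the `n`-th Cauchy coefficient has norm
`≤ B·R⁻ⁿ`. -/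
theorem norm_cauchyPowerSeries_le_of_bound {g : ℂ → ℂ} {R B : ℝ} (hR : 0 < R)
    (hB : ∀ z ∈ sphere (0 : ℂ) R, ‖g z‖ ≤ B) (n : ℕ) :
    ‖cauchyPowerSeries g 0 R n‖ ≤ B * R⁻¹ ^ n := by
  have h1 := norm_cauchyPowerSeries_le g 0 R n
  have hint : ∫ θ : ℝ in (0)..2 * Real.pi, ‖g (circleMap 0 R θ)‖ ≤ B * |2 * Real.pi - 0| := by
    refine (le_abs_self _).trans ?_
    rw [← Real.norm_eq_abs]
    refine intervalIntegral.norm_integral_le_of_norm_le_const fun θ _ => ?_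
    rw [Real.norm_eq_abs, abs_norm]
    exact hB _ (circleMap_mem_sphere 0 hR.le θ)
  rw [sub_zero, abs_of_pos Real.two_pi_pos] at hint
  rw [abs_of_pos hR] at h1
  calc ‖cauchyPowerSeries g 0 R n‖ ≤ ((2 * Real.pi)⁻¹ * ∫ θ : ℝ in (0)..2 * Real.pi, ‖g (circleMap 0 R θ)‖) * R⁻¹ ^ n := h1
    _ ≤ ((2 * Real.pi)⁻¹ * (B * (2 * Real.pi))) * R⁻¹ ^ n := by gcongr
    _ = B * R⁻¹ ^ n := by field_simp

/-- **§4 — Cauchy–Taylor to second order.** If `g` is complex differentiable on the closed disc `|z| ≤ R` and bounded by `B` on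
its boundary circle, then for `|t| ≤ R/2`:
`‖g'(0)‖ ≤ B/R`, `‖g''(0)‖ ≤ 2B/R²`, and `‖g(t) − g(0) − g'(0)t − g''(0)t²/2‖ ≤ 2B(|t|/R)³`. -/
theorem cauchy_taylor_two {g : ℂ → ℂ} {R B : ℝ} (hR : 0 < R) (hg : DifferentiableOn ℂ g (closedBall 0 R))
    (hB : ∀ z ∈ sphere (0 : ℂ) R, ‖g z‖ ≤ B) {t : ℂ} (ht : ‖t‖ ≤ R / 2) :
    ‖deriv g 0‖ ≤ B / R ∧ ‖iteratedDeriv 2 g 0‖ ≤ 2 * B / R ^ 2 ∧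
      ‖g t - g 0 - deriv g 0 * t - iteratedDeriv 2 g 0 / 2 * t ^ 2‖ ≤ 2 * B * (‖t‖ / R) ^ 3 := by
  set Rn : NNReal := R.toNNReal with hRn
  have hRn' : (Rn : ℝ) = R := Real.coe_toNNReal _ hR.le
  have hRn0 : 0 < Rn := by rw [← NNReal.coe_pos, hRn']; exact hR
  have hg' : DifferentiableOn ℂ g (closedBall 0 (Rn : ℝ)) := by rw [hRn']; exact hg
  set q := cauchyPowerSeries g 0 R with hq
  have hps : HasFPowerSeriesOnBall g q 0 Rn := by
    have := hg'.hasFPowerSeriesOnBall hRn0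
    rwa [hRn'] at this
  -- coefficient bounds
  have hcoef : ∀ n, ‖q n‖ ≤ B * R⁻¹ ^ n := norm_cauchyPowerSeries_le_of_bound hR hB
  have hB0 : 0 ≤ B := (norm_nonneg _).trans (hB (R : ℂ) (by simp [abs_of_pos hR]))
  have hdiag : ∀ n, q n (fun _ => t) = t ^ n * q n (fun _ => 1) := by
    intro n
    have := (q n).map_smul_univ (fun _ => t) (fun _ => (1 : ℂ))
    simp only [smul_eq_mul, mul_one, Finset.prod_const, Finset.card_univ, Fintype.card_fin] at this
    exact this
  have hone : ∀ n, ‖q n (fun _ => (1 : ℂ))‖ ≤ B * R⁻¹ ^ n := by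
    intro n
    have := (q n).le_opNorm (fun _ => (1 : ℂ))
    simp only [norm_one, Finset.prod_const_one, mul_one] at this
    exact this.trans (hcoef n)
  -- identification of the first three coefficients
  have h0 : q 0 (fun _ => t) = g 0 := hps.coeff_zero _
  have h1 : q 1 (fun _ => (1 : ℂ)) = deriv g 0 := hps.hasFPowerSeriesAt.deriv.symm
  have h2 : q 2 (fun _ => (1 : ℂ)) = iteratedDeriv 2 g 0 / 2 := by
    have := hps.factorial_smul (1 : ℂ) 2
    rw [Nat.factorial_two, nsmul_eq_mul, ← iteratedDeriv_eq_iteratedFDeriv] at this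
    rw [← this]; push_cast; ring
  refine ⟨?_, ?_, ?_⟩
  · rw [← h1]; calc ‖q 1 fun _ => (1 : ℂ)‖ ≤ B * R⁻¹ ^ 1 := hone 1
      _ = B / R := by rw [pow_one, div_eq_mul_inv]
  · have : iteratedDeriv 2 g 0 = 2 * q 2 (fun _ => (1 : ℂ)) := by rw [h2]; ring
    rw [this, norm_mul, Complex.norm_two]
    calc 2 * ‖q 2 fun _ => (1 : ℂ)‖ ≤ 2 * (B * R⁻¹ ^ 2) := by gcongr; exact hone 2
      _ = 2 * B / R ^ 2 := by rw [inv_pow]; ring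
  · -- the power series at `t`, split after three terms
    have htR : ‖t‖ < R := by linarith
    have hmem : t ∈ Metric.eball (0 : ℂ) Rn := by
      rw [Metric.eball_coe, mem_ball_zero_iff, hRn']; exact htR
    have hsum : HasSum (fun n => q n fun _ => t) (g t) := by simpa using hps.hasSum hmem
    have htail : HasSum (fun n => q (n + 3) fun _ => t) (g t - ∑ i ∈ range 3, q i fun _ => t) :=
      (hasSum_nat_add_iff' 3).mpr hsum
    have hS : ∑ i ∈ range 3, q i (fun _ => t) = g 0 + deriv g 0 * t + iteratedDeriv 2 g 0 / 2 * t ^ 2 := by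
      rw [Finset.sum_range_succ, Finset.sum_range_succ, Finset.sum_range_succ, Finset.sum_range_zero, zero_add, h0,
        hdiag 1, hdiag 2, h1, h2]
      ring
    rw [hS] at htail
    -- geometric majorant
    set ρ := ‖t‖ / R with hρ
    have hρ0 : 0 ≤ ρ := by positivity
    have hρ1 : ρ ≤ 1 / 2 := by rw [hρ, div_le_iff₀ hR]; linarith
    have hgeo : HasSum (fun n : ℕ => B * ρ ^ 3 * ρ ^ n) (B * ρ ^ 3 * (1 - ρ)⁻¹) :=
      (hasSum_geometric_of_lt_one hρ0 (by linarith)).mul_left _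
    have hbd : ∀ n, ‖q (n + 3) fun _ => t‖ ≤ B * ρ ^ 3 * ρ ^ n := by
      intro n
      rw [hdiag, norm_mul, norm_pow]
      calc ‖t‖ ^ (n + 3) * ‖q (n + 3) fun _ => (1 : ℂ)‖ ≤ ‖t‖ ^ (n + 3) * (B * R⁻¹ ^ (n + 3)) := by
            gcongr; exact hone _
        _ = B * ρ ^ 3 * ρ ^ n := by rw [hρ, div_eq_mul_inv, mul_pow, mul_pow]; ring
    have key := htail.norm_le_of_bounded hgeo hbd
    have e : g t - g 0 - deriv g 0 * t - iteratedDeriv 2 g 0 / 2 * t ^ 2 =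
        g t - (g 0 + deriv g 0 * t + iteratedDeriv 2 g 0 / 2 * t ^ 2) := by ring
    rw [e]
    refine key.trans ?_
    have h1ρ : (1 - ρ)⁻¹ ≤ 2 := by rw [inv_le_comm₀ (by linarith) (by norm_num)]; linarith
    calc B * ρ ^ 3 * (1 - ρ)⁻¹ ≤ B * ρ ^ 3 * 2 := by gcongr
      _ = 2 * B * ρ ^ 3 := by ring

end Summit.Ventures.CertifiedManyBodySolver.Theorems.TcThermcert1.ZeroFreeCorridor

end
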